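import Mathlib
import HarnessLib
import Literature.Analysis.FluidPDE.VectorCalculus
import Literature.Analysis.FluidPDE.DecayingSelfSimilarEulerProfile

/-!
# `ImplosionDoor.TangentialCurlFreeTriviality` (stmt-NavierStokesRegularity-25306) — KINEMATIC RIGIDITY, part 1/2:
# the Bochner identity for sphere-tangential fields on `ℝ³` (algebra and calculus)

Support file for the line's research stub `stub_sliceZero` (crux `TangentialCurlFreeTriviality`, line `birth`,
planner ns-idea-6).  Part 2/2 (`…TangentialCurlFreeTrivialityKinematics`) proves: a `C²` field `w` on `ℝ³` with
`⟪w(y), y⟫ = 0`, `div w = 0`, `⟪curl w(y), y⟫ = 0` vanishes identically — classically "harmonic 1-forms on `S²`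
are zero" [Davidson 2001, App.; Majda–Bertozzi 2002, §1]; here by the BOCHNER ARGUMENT written in ambient
coordinates, with no manifold or Hodge theory.  This file supplies the two pointwise ingredients.

Write `A = Dw(y)`.  Differentiating `⟪w(y), y⟫ ≡ 0` gives `⟪A h, y⟫ = −⟪w(y), h⟫` (`inner_fderiv_apply_eq`).
* ALGEBRA (`key_ineq`).  In an orthonormal frame `(b₀, b₁, b₂)` with `b₂ = y/|y|` (Mathlib's
  `Orthonormal.exists_orthonormalBasis_extension_of_card_eq`) and `aᵢⱼ = ⟪bᵢ, A bⱼ⟫`: tangency gives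
  `|y| a₂ⱼ = −⟪w, bⱼ⟫` and `⟪w, b₂⟫ = 0`; the radial vorticity condition `⟪curl w, y⟫ = 0` is exactly the
  symmetry `a₁₀ = a₀₁` of the tangential block (tree `inner_cross_curl_left`: `⟪curl w × a, b⟫ = ⟪b, A a⟫ − ⟪a, A b⟫`);
  hence `|y|² tr(A²) + 2⟪w, A y⟫ = |y|² (a₀₀² + a₁₁² + 2 a₀₁²) ≥ 0` — the squared norm of the (symmetric)
  tangential block; the radial-derivative entries cancel exactly.
* CALCULUS (`divergence_bochnerField`).  The field `U(y) = |y|² (w·∇)w + |w|² y` is tangential and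
  `div U = |y|² tr(A²) + 2⟪w, A y⟫ + |w|²` (flat identity `div (w·∇)w = tr((Dw)²) + w·∇ div w`, symmetry of
  second derivatives, `div w ≡ 0`); and radial cut-offs commute with tangential fields:
  `div (k(|y|²) U) = k(|y|²) div U` (`divergence_radial_smul`).

HONEST FRAMING: pure vector calculus on `ℝ³` (kinematics of a HYPOTHETICAL blow-up profile's slice); nothing
here bears on Navier–Stokes regularity; no summit statement is proved.
-/

noncomputable section

-- the summit and its single sub-problem share the name (CONVENTIONS §1), as in every Theorems file
set_option linter.dupNamespace false

namespace Summit.NavierStokesRegularity.NavierStokesRegularity.Theorems.ImplosionDoorTangentialCurlFreeTrivialityBochner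

open Set Function MeasureTheory Metric
open scoped RealInnerProductSpace InnerProductSpace Topology
open Literature.Analysis Literature.Analysis.FluidPDE

/-! ### Algebra: cross products, frames, traces -/

/-- `⟪a × c, a⟫ = 0`. [folklore] -/
private theorem inner_cross_self_left' (a c : EuclideanSpace ℝ (Fin 3)) : ⟪cross a c, a⟫ = 0 := by
  simp [cross, crossProduct, Fin.sum_univ_three, inner]
  ring

/-- `⟪a × a, c⟫ = 0`. [folklore] -/
private theorem inner_cross_self_fst (a c : EuclideanSpace ℝ (Fin 3)) : ⟪cross a a, c⟫ = 0 := by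
  simp [cross, crossProduct, Fin.sum_univ_three, inner]
  ring

/-- Additivity of the cross product in the first slot. [folklore] -/
private theorem cross_add_left (a a' c : EuclideanSpace ℝ (Fin 3)) :
    cross (a + a') c = cross a c + cross a' c := by
  simp [cross]

/-- Homogeneity of the cross product in the first slot. [folklore] -/
private theorem cross_smul_left (r : ℝ) (a c : EuclideanSpace ℝ (Fin 3)) :
    cross (r • a) c = r • cross a c := by
  simp [cross]

/-- `tr(T²) = ∑ᵢⱼ ⟪bᵢ, T bⱼ⟫ ⟪bⱼ, T bᵢ⟫` in any orthonormal frame `b` of `ℝ³`. [folklore] -/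
theorem trace_comp_self_eq_sum (T : EuclideanSpace ℝ (Fin 3) →ₗ[ℝ] EuclideanSpace ℝ (Fin 3))
    (b : OrthonormalBasis (Fin 3) ℝ (EuclideanSpace ℝ (Fin 3))) :
    LinearMap.trace ℝ _ (T ∘ₗ T) = ∑ i, ∑ j, ⟪b i, T (b j)⟫ * ⟪b j, T (b i)⟫ := by
  rw [LinearMap.trace_eq_sum_inner _ b]
  refine Finset.sum_congr rfl fun i _ => ?_
  rw [LinearMap.comp_apply]
  conv_lhs => rw [← b.sum_repr' (T (b i))]
  simp only [map_sum, map_smul, inner_sum, inner_smul_right]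
  refine Finset.sum_congr rfl fun j _ => ?_
  ring

/-- An orthonormal frame of `ℝ³` whose last vector is `y/|y|` (`y ≠ 0`). [folklore] -/
theorem exists_orthonormalBasis_last_eq {y : EuclideanSpace ℝ (Fin 3)} (hy : y ≠ 0) :
    ∃ b : OrthonormalBasis (Fin 3) ℝ (EuclideanSpace ℝ (Fin 3)), b 2 = ‖y‖⁻¹ • y := by
  have hn : ‖(‖y‖⁻¹ • y : EuclideanSpace ℝ (Fin 3))‖ = 1 := norm_smul_inv_norm hy
  have hv : Orthonormal ℝ (({2} : Set (Fin 3)).restrict fun _ : Fin 3 =>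
      (‖y‖⁻¹ • y : EuclideanSpace ℝ (Fin 3))) := by
    classical
    rw [orthonormal_iff_ite]
    rintro ⟨i, hi⟩ ⟨j, hj⟩
    have hij : (⟨i, hi⟩ : ({2} : Set (Fin 3))) = ⟨j, hj⟩ := by
      rw [Set.mem_singleton_iff] at hi hj
      subst hi; subst hj; rfl
    rw [if_pos hij]
    simp only [Set.restrict_apply, real_inner_self_eq_norm_sq, hn, one_pow]
  obtain ⟨b, hb⟩ := hv.exists_orthonormalBasis_extension_of_card_eq (finrank_euclideanSpace_fin)
  exact ⟨b, hb 2 rfl⟩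

/-- **The algebraic heart (Bochner positivity).**  If `A = Du(y)` satisfies the differentiated tangency
relation `⟪A h, y⟫ = −⟪W, h⟫` (`W = u(y)` in the application), `⟪W, y⟫ = 0`, and the radial vorticity
vanishes, `⟪curl u(y), y⟫ = 0`, then `|y|² tr(A²) + 2⟪W, A y⟫ ≥ 0` (it equals `|y|²` times the squared
Frobenius norm of the symmetric tangential block of `A`). [folklore] -/
theorem key_ineq (u : EuclideanSpace ℝ (Fin 3) → EuclideanSpace ℝ (Fin 3)) (y W : EuclideanSpace ℝ (Fin 3))
    (h1 : ∀ h, ⟪fderiv ℝ u y h, y⟫ = -⟪W, h⟫) (h2 : ⟪W, y⟫ = 0) (hc : ⟪curl u y, y⟫ = 0) :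
    0 ≤ ‖y‖ ^ 2 * LinearMap.trace ℝ _ ((fderiv ℝ u y : EuclideanSpace ℝ (Fin 3) →ₗ[ℝ] EuclideanSpace ℝ (Fin 3)) ∘ₗ
        (fderiv ℝ u y : EuclideanSpace ℝ (Fin 3) →ₗ[ℝ] EuclideanSpace ℝ (Fin 3))) + 2 * ⟪W, fderiv ℝ u y y⟫ := by
  by_cases hy : y = 0
  · simp [hy]
  obtain ⟨b, hb⟩ := exists_orthonormalBasis_last_eq hy
  set A : EuclideanSpace ℝ (Fin 3) →L[ℝ] EuclideanSpace ℝ (Fin 3) := fderiv ℝ u y with hA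
  have hr : ‖y‖ ≠ 0 := norm_ne_zero_iff.2 hy
  have hyb : y = ‖y‖ • b 2 := by
    rw [hb, smul_smul, mul_inv_cancel₀ hr, one_smul]
  -- the frame relations: tangency
  have e : ∀ j, ‖y‖ * ⟪b 2, A (b j)⟫ = -⟪W, b j⟫ := by
    intro j
    have := h1 (b j)
    rw [hyb, inner_smul_right, real_inner_comm] at this
    exact this
  have hW2 : ⟪W, b 2⟫ = 0 := by
    have := h2
    rw [hyb, inner_smul_right] at this
    exact (mul_eq_zero.1 this).resolve_left hr
  -- zero radial vorticity = symmetry of the tangential block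
  have hω2 : ⟪b 2, curl u y⟫ = 0 := by
    have : ⟪curl u y, ‖y‖ • b 2⟫ = 0 := by rw [← hyb]; exact hc
    rw [inner_smul_right] at this
    rw [real_inner_comm]
    exact (mul_eq_zero.1 this).resolve_left hr
  have h01 : ⟪b 1, A (b 0)⟫ - ⟪b 0, A (b 1)⟫ = 0 := by
    rw [hA, ← inner_cross_curl_left u y (b 0) (b 1)]
    conv_lhs => rw [← b.sum_repr' (curl u y)]
    simp only [Fin.sum_univ_three, cross_add_left, cross_smul_left, inner_add_left, inner_smul_left,
      RCLike.conj_to_real]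
    rw [inner_cross_self_fst, inner_cross_self_left', hω2]
    ring
  have hWAy : ⟪W, A y⟫ = ‖y‖ * ∑ i, ⟪W, b i⟫ * ⟪b i, A (b 2)⟫ := by
    have hAy : A y = ‖y‖ • A (b 2) := by
      conv_lhs => rw [hyb]
      rw [map_smul]
    rw [hAy, inner_smul_right, b.sum_inner_mul_inner]
  rw [trace_comp_self_eq_sum _ b, hWAy]
  simp only [Fin.sum_univ_three, ContinuousLinearMap.coe_coe]
  have e0 := e 0
  have e1 := e 1
  have e2 := e 2
  have key :
      ‖y‖ ^ 2 * (⟪b 0, A (b 0)⟫ * ⟪b 0, A (b 0)⟫ + ⟪b 0, A (b 1)⟫ * ⟪b 1, A (b 0)⟫ + ⟪b 0, A (b 2)⟫ * ⟪b 2, A (b 0)⟫ +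
          (⟪b 1, A (b 0)⟫ * ⟪b 0, A (b 1)⟫ + ⟪b 1, A (b 1)⟫ * ⟪b 1, A (b 1)⟫ + ⟪b 1, A (b 2)⟫ * ⟪b 2, A (b 1)⟫) +
          (⟪b 2, A (b 0)⟫ * ⟪b 0, A (b 2)⟫ + ⟪b 2, A (b 1)⟫ * ⟪b 1, A (b 2)⟫ + ⟪b 2, A (b 2)⟫ * ⟪b 2, A (b 2)⟫)) +
        2 * (‖y‖ * (⟪W, b 0⟫ * ⟪b 0, A (b 2)⟫ + ⟪W, b 1⟫ * ⟪b 1, A (b 2)⟫ + ⟪W, b 2⟫ * ⟪b 2, A (b 2)⟫)) =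
      ‖y‖ ^ 2 * (⟪b 0, A (b 0)⟫ ^ 2 + ⟪b 1, A (b 1)⟫ ^ 2 + 2 * ⟪b 0, A (b 1)⟫ ^ 2) := by
    linear_combination (2 * ‖y‖ ^ 2 * ⟪b 0, A (b 1)⟫) * h01 + (2 * ‖y‖ * ⟪b 0, A (b 2)⟫) * e0 +
      (2 * ‖y‖ * ⟪b 1, A (b 2)⟫) * e1 + (‖y‖ * ⟪b 2, A (b 2)⟫) * e2 + (‖y‖ * ⟪b 2, A (b 2)⟫) * hW2
  rw [key]
  positivity

/-! ### Calculus: the Bochner field `U = |y|² (w·∇)w + |w|² y` -/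

variable {w : EuclideanSpace ℝ (Fin 3) → EuclideanSpace ℝ (Fin 3)}

/-- Differentiated tangency: `⟪w(y), y⟫ ≡ 0` gives `⟪Dw(y) h, y⟫ = −⟪w(y), h⟫`. [folklore] -/
theorem inner_fderiv_apply_eq (hw : Differentiable ℝ w) (htan : ∀ y, ⟪w y, y⟫ = 0)
    (y h : EuclideanSpace ℝ (Fin 3)) : ⟪fderiv ℝ w y h, y⟫ = -⟪w y, h⟫ := by
  have h0 : fderiv ℝ (fun t => ⟪w t, t⟫) y h = 0 := by
    have : (fun t => ⟪w t, t⟫) = fun _ => (0 : ℝ) := funext htan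
    rw [this]
    simp
  have h1 : fderiv ℝ (fun t => ⟪w t, t⟫) y h = ⟪w y, h⟫ + ⟪fderiv ℝ w y h, y⟫ := by
    have hid : DifferentiableAt ℝ (fun t : EuclideanSpace ℝ (Fin 3) => t) y := differentiableAt_id
    rw [fderiv_inner_apply ℝ (hw y) hid]
    simp
  linarith

/-- The derivative of the Bochner field of a `C²` field (product and chain rules). [folklore] -/
theorem hasFDerivAt_bochnerField (hw : ContDiff ℝ 2 w) (y : EuclideanSpace ℝ (Fin 3)) :
    HasFDerivAt (fun y => ‖y‖ ^ 2 • fderiv ℝ w y (w y) + ‖w y‖ ^ 2 • y)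
      (‖y‖ ^ 2 • ((fderiv ℝ w y).comp (fderiv ℝ w y) + (fderiv ℝ (fderiv ℝ w) y).flip (w y)) +
          (2 • innerSL ℝ y).smulRight (fderiv ℝ w y (w y)) +
        (‖w y‖ ^ 2 • ContinuousLinearMap.id ℝ (EuclideanSpace ℝ (Fin 3)) +
          (2 • (innerSL ℝ (w y)).comp (fderiv ℝ w y)).smulRight y)) y := by
  have hA : HasFDerivAt w (fderiv ℝ w y) y := (hw.differentiable two_ne_zero y).hasFDerivAt
  have hA' : HasFDerivAt (fderiv ℝ w) (fderiv ℝ (fderiv ℝ w) y) y :=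
    ((hw.fderiv_right (m := 1) (by norm_num)).differentiable one_ne_zero y).hasFDerivAt
  have h1 : HasFDerivAt (fun z => fderiv ℝ w z (w z))
      ((fderiv ℝ w y).comp (fderiv ℝ w y) + (fderiv ℝ (fderiv ℝ w) y).flip (w y)) y :=
    hA'.clm_apply hA
  have h2 : HasFDerivAt (fun z : EuclideanSpace ℝ (Fin 3) => ‖z‖ ^ 2) (2 • innerSL ℝ y) y :=
    (hasStrictFDerivAt_norm_sq y).hasFDerivAt
  have h4 : HasFDerivAt (fun z => ‖w z‖ ^ 2) (2 • (innerSL ℝ (w y)).comp (fderiv ℝ w y)) y := hA.norm_sq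
  exact (h2.smul h1).add (h4.smul (hasFDerivAt_id y))

/-- The Bochner field of a `C²` field is `C¹`. [folklore] -/
theorem contDiff_bochnerField (hw : ContDiff ℝ 2 w) : ContDiff ℝ 1 (fun y => ‖y‖ ^ 2 • fderiv ℝ w y (w y) + ‖w y‖ ^ 2 • y) := by
  have h1 : ContDiff ℝ 1 (fun z => fderiv ℝ w z (w z)) :=
    (hw.fderiv_right (m := 1) (by norm_num)).clm_apply (hw.of_le (by norm_num))
  have h2 : ContDiff ℝ 1 (fun z : EuclideanSpace ℝ (Fin 3) => ‖z‖ ^ 2) := contDiff_norm_sq ℝ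
  have h4 : ContDiff ℝ 1 (fun z => ‖w z‖ ^ 2) := (hw.of_le (by norm_num)).norm_sq ℝ
  exact (h2.smul h1).add (h4.smul contDiff_id)

/-- The Bochner field of a sphere-tangential field is sphere-tangential:
`⟪U(y), y⟫ = |y|² ⟪Dw w, y⟫ + |w|²|y|² = 0`. [folklore] -/
theorem inner_bochnerField_self (hw : Differentiable ℝ w) (htan : ∀ y, ⟪w y, y⟫ = 0)
    (y : EuclideanSpace ℝ (Fin 3)) : ⟪‖y‖ ^ 2 • fderiv ℝ w y (w y) + ‖w y‖ ^ 2 • y, y⟫ = 0 := by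
  rw [inner_add_left, inner_smul_left, inner_smul_left, inner_fderiv_apply_eq hw htan,
    real_inner_self_eq_norm_sq, real_inner_self_eq_norm_sq]
  simp only [RCLike.conj_to_real]
  ring

/-- The trace of a rank-one map `h ↦ φ(h) v` is `φ(v)`. [folklore] -/
theorem trace_smulRight (φ : EuclideanSpace ℝ (Fin 3) →L[ℝ] ℝ) (v : EuclideanSpace ℝ (Fin 3)) :
    LinearMap.trace ℝ _ ((φ.smulRight v : EuclideanSpace ℝ (Fin 3) →L[ℝ] EuclideanSpace ℝ (Fin 3)) :
      EuclideanSpace ℝ (Fin 3) →ₗ[ℝ] EuclideanSpace ℝ (Fin 3)) = φ v := by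
  have : ((φ.smulRight v : EuclideanSpace ℝ (Fin 3) →L[ℝ] EuclideanSpace ℝ (Fin 3)) :
      EuclideanSpace ℝ (Fin 3) →ₗ[ℝ] EuclideanSpace ℝ (Fin 3)) =
        (φ : EuclideanSpace ℝ (Fin 3) →ₗ[ℝ] ℝ).smulRight v := by
    ext h; rfl
  rw [this, LinearMap.trace_smulRight]
  rfl

/-- `div w ≡ 0` differentiated: `tr(D²w(y) h) = D(div w)(y) h = 0` (the trace is a continuous linear
functional of the derivative). [folklore] -/
theorem trace_fderiv_fderiv_eq_zero (hw : ContDiff ℝ 2 w) (hdiv : ∀ y, VectorCalculus.divergence w y = 0)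
    (y h : EuclideanSpace ℝ (Fin 3)) :
    LinearMap.trace ℝ _ ((fderiv ℝ (fderiv ℝ w) y h : EuclideanSpace ℝ (Fin 3) →L[ℝ] EuclideanSpace ℝ (Fin 3)) :
      EuclideanSpace ℝ (Fin 3) →ₗ[ℝ] EuclideanSpace ℝ (Fin 3)) = 0 := by
  set T : (EuclideanSpace ℝ (Fin 3) →L[ℝ] EuclideanSpace ℝ (Fin 3)) →ₗ[ℝ] ℝ :=
    (LinearMap.trace ℝ (EuclideanSpace ℝ (Fin 3))) ∘ₗ (ContinuousLinearMap.coeLM ℝ) with hT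
  set Tc : (EuclideanSpace ℝ (Fin 3) →L[ℝ] EuclideanSpace ℝ (Fin 3)) →L[ℝ] ℝ :=
    LinearMap.toContinuousLinearMap T with hTc
  have hTc : ∀ L : EuclideanSpace ℝ (Fin 3) →L[ℝ] EuclideanSpace ℝ (Fin 3),
      Tc L = LinearMap.trace ℝ _ (L : EuclideanSpace ℝ (Fin 3) →ₗ[ℝ] EuclideanSpace ℝ (Fin 3)) := fun L => rfl
  have hA' : HasFDerivAt (fderiv ℝ w) (fderiv ℝ (fderiv ℝ w) y) y :=
    ((hw.fderiv_right (m := 1) (by norm_num)).differentiable one_ne_zero y).hasFDerivAt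
  have hcomp : HasFDerivAt (fun z => Tc (fderiv ℝ w z)) (Tc.comp (fderiv ℝ (fderiv ℝ w) y)) y :=
    Tc.hasFDerivAt.comp y hA'
  have hzero : (fun z => Tc (fderiv ℝ w z)) = fun _ => (0 : ℝ) := by
    funext z
    rw [hTc]
    exact hdiv z
  have h0 : HasFDerivAt (fun z => Tc (fderiv ℝ w z)) (0 : EuclideanSpace ℝ (Fin 3) →L[ℝ] ℝ) y := by
    rw [hzero]
    exact hasFDerivAt_const 0 y
  have := congrArg (fun L : EuclideanSpace ℝ (Fin 3) →L[ℝ] ℝ => L h) (hcomp.unique h0)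
  simpa [hTc] using this

/-- **Divergence of the Bochner field** of a `C²` sphere-tangential divergence-free field:
`div U = |y|² tr((Dw)²) + 2⟪w, Dw y⟫ + |w|²` — the flat identity `div (w·∇)w = tr((Dw)²) + w·∇div w`
(`div w ≡ 0`, symmetric second derivative) plus `div(|y|²·) `/`div(|w|² y)` bookkeeping, the radial terms
`2⟪y, Dw w⟫ = −2|w|²` coming from tangency. [folklore] -/
theorem divergence_bochnerField (hw : ContDiff ℝ 2 w) (htan : ∀ y, ⟪w y, y⟫ = 0)
    (hdiv : ∀ y, VectorCalculus.divergence w y = 0) (y : EuclideanSpace ℝ (Fin 3)) :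
    VectorCalculus.divergence (fun y => ‖y‖ ^ 2 • fderiv ℝ w y (w y) + ‖w y‖ ^ 2 • y) y =
      ‖y‖ ^ 2 * LinearMap.trace ℝ _ ((fderiv ℝ w y : EuclideanSpace ℝ (Fin 3) →ₗ[ℝ] EuclideanSpace ℝ (Fin 3)) ∘ₗ
          (fderiv ℝ w y : EuclideanSpace ℝ (Fin 3) →ₗ[ℝ] EuclideanSpace ℝ (Fin 3))) +
        2 * ⟪w y, fderiv ℝ w y y⟫ + ‖w y‖ ^ 2 := by
  have hsymm : IsSymmSndFDerivAt ℝ w y := hw.contDiffAt.isSymmSndFDerivAt (by simp)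
  have hflip : ((fderiv ℝ (fderiv ℝ w) y).flip (w y) : EuclideanSpace ℝ (Fin 3) →L[ℝ] EuclideanSpace ℝ (Fin 3)) =
      fderiv ℝ (fderiv ℝ w) y (w y) :=
    ContinuousLinearMap.ext fun h => by
      rw [ContinuousLinearMap.flip_apply]
      exact hsymm h (w y)
  have hAwy : ⟪fderiv ℝ w y (w y), y⟫ = -⟪w y, w y⟫ :=
    inner_fderiv_apply_eq (hw.differentiable two_ne_zero) htan y (w y)
  rw [real_inner_comm] at hAwy
  rw [VectorCalculus.divergence, (hasFDerivAt_bochnerField hw y).fderiv, hflip]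
  simp only [ContinuousLinearMap.toLinearMap_add, ContinuousLinearMap.toLinearMap_smul, map_add, map_smul,
    trace_smulRight, trace_fderiv_fderiv_eq_zero hw hdiv, ContinuousLinearMap.toLinearMap_comp,
    ContinuousLinearMap.coe_id, LinearMap.trace_id, finrank_euclideanSpace_fin, smul_eq_mul, add_zero,
    smul_apply, innerSL_apply_apply, ContinuousLinearMap.comp_apply, nsmul_eq_mul]
  rw [hAwy, real_inner_self_eq_norm_sq]
  push_cast
  ring

/-- **Radial cut-offs commute with tangential fields**: for `ψ(y) = k(|y|²)` and a `C¹` sphere-tangential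
field `U`, `div(ψ U) = ψ div U` (`⟪∇ψ, U⟫ = 2k′(|y|²)⟪y, U⟫ = 0`). [folklore] -/
theorem divergence_radial_smul {k : ℝ → ℝ} (hk : Differentiable ℝ k)
    {U : EuclideanSpace ℝ (Fin 3) → EuclideanSpace ℝ (Fin 3)} (hU : Differentiable ℝ U)
    (hUtan : ∀ y, ⟪U y, y⟫ = 0) (y : EuclideanSpace ℝ (Fin 3)) :
    VectorCalculus.divergence (fun z => k (‖z‖ ^ 2) • U z) y = k (‖y‖ ^ 2) * VectorCalculus.divergence U y := by
  have hN : HasFDerivAt (fun z : EuclideanSpace ℝ (Fin 3) => ‖z‖ ^ 2) (2 • innerSL ℝ y) y :=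
    (hasStrictFDerivAt_norm_sq y).hasFDerivAt
  have hψ : HasFDerivAt (fun z : EuclideanSpace ℝ (Fin 3) => k (‖z‖ ^ 2))
      (deriv k (‖y‖ ^ 2) • (2 • innerSL ℝ y)) y :=
    HasDerivAt.comp_hasFDerivAt (h₂ := k) y (hk _).hasDerivAt hN
  have hV : HasFDerivAt (fun z : EuclideanSpace ℝ (Fin 3) => k (‖z‖ ^ 2) • U z)
      (k (‖y‖ ^ 2) • fderiv ℝ U y + (deriv k (‖y‖ ^ 2) • (2 • innerSL ℝ y)).smulRight (U y)) y :=
    hψ.smul (hU y).hasFDerivAt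
  rw [VectorCalculus.divergence, hV.fderiv, VectorCalculus.divergence]
  simp only [ContinuousLinearMap.toLinearMap_add, ContinuousLinearMap.toLinearMap_smul, map_add, map_smul,
    trace_smulRight, smul_eq_mul, smul_apply, innerSL_apply_apply, nsmul_eq_mul]
  rw [real_inner_comm, hUtan y]
  ring

end Summit.NavierStokesRegularity.NavierStokesRegularity.Theorems.ImplosionDoorTangentialCurlFreeTrivialityBochner

end
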